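import Mathlib
import HarnessLib

/-!
# Non-square descent — RANK ONE SURVIVES REDUCTION MOD `ϖ` (the hypothesis `hrank` of the S3 (c) certificate, DERIVED) for the seed
# crux `SignedMuSeedAtTwoPlus` stmt-BirchSwinnertonDyer-21438 (parent Kμ⁺ `SignedMuVanishingAtTwoPlus` stmt-BirchSwinnertonDyer-20689,
# route ResidualThetaTransportAtTwo), line card `Cruxes/SignedMuSeedAtTwoPlus/Lines/nonsquare-descent.md`

Cell `bsd-wall`, width seat `bsd-wall-rtt-p4-w2` g18 (`--supports`, closes nothing).  THEOREMS ONLY; BSD is not proved by this and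
nothing arithmetic is asserted: module algebra over a commutative ring.

The S3 (c) certificate `…NonsquareDescent.isTorsion_quotient_iff_exists_proj_ne_zero` (seat g17, file
`Theorems/…NonsquareDescentCertificate.lean`) takes as INPUT the hypothesis
`hrank : ∀ v w : V_∞, ∃ a b : k⟦X⟧, (a ≠ 0 ∨ b ≠ 0) ∧ a • v + b • w = 0` («`V_∞ = Ē^χ/2` has `𝔽₄⟦T⟧`-rank `≤ 1`»), which the
line card (stub S3, input (c); hypothesis ledger of `Cruxes/SignedMuVanishingAtTwoPlus/NonsquareDescentKernel.md` §2) obtains from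
«`rank_{Λ'} Ē^χ = 1`».  This file proves that passage in module form: **rank `≤ 1` of a torsion-free module survives reduction
modulo `ϖ`.**  Dictionary: `R = Λ' = 𝒪⟦T⟧`, `ϖ = 2`, `S = Λ'/2 = 𝔽₄⟦T⟧`, `φ : R →+* S` the reduction, `E = Ē^χ`, `V = E/ϖE = V_∞`,
`q : E → V` the quotient map.

* §1 `smul_left_cancel_of_injective`, `rank_le_one_of_injective` — a module that EMBEDS `R`-linearly into a domain `R` (a lattice
  of rank one, `Ē^χ ↪ Λ'`) is torsion-free and has rank `≤ 1` (any two elements are linearly dependent);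
  `rank_le_one_of_not_linearIndependent_pair` — the same hypothesis from Mathlib's `LinearIndependent` currency.
* §2 `exists_pow_mul_not_dvd_and` — extraction of the maximal common power of `ϖ` from a pair `(a, b)` one of whose entries has finite
  `ϖ`-multiplicity.
* §3 **`rank_le_one_modP`** — `E` torsion-free of rank `≤ 1` over `R`, every non-zero scalar of finite `ϖ`-multiplicity, `q : E → V` an
  `R`-linear surjection: any two elements of `V` satisfy a relation `a • v + b • w = 0` with `¬(ϖ ∣ a ∧ ϖ ∣ b)`;
  **`rank_le_one_modP_of_ringHom`** — the same read through a ring map `φ : R → S` killing exactly the multiples of `ϖ` and a compatible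
  `S`-module structure on `V`: `∃ a b : S, (a ≠ 0 ∨ b ≠ 0) ∧ a • v + b • w = 0`, i.e. LITERALLY the hypothesis `hrank` of the certificate
  (with `S = k⟦X⟧`).  No kernel condition on `q` is needed for this direction.

[folklore]
-/

set_option autoImplicit false
-- the Theorems namespace of this sub repeats the summit name by design (D-0017 nested layout)
set_option linter.dupNamespace false

namespace Summit.BirchSwinnertonDyer.BirchSwinnertonDyer.Theorems.SignedMuAtTwo.NonsquareDescent

/-! ## §1 Rank one and torsion-freeness from an embedding into `R` -/

section Embedding

variable {R : Type*} [CommRing R] {E : Type*} [AddCommGroup E] [Module R E]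

/-- A module embedding `R`-linearly into a domain `R` is torsion-free: `a ≠ 0`, `a • e = 0 ⇒ e = 0` («`Ē^χ ↪ Λ'` is
`Λ'`-torsion-free»). [folklore] -/
theorem smul_left_cancel_of_injective [IsDomain R] (ι : E →ₗ[R] R) (hι : Function.Injective ι)
    {a : R} (ha : a ≠ 0) {e : E} (h : a • e = 0) : e = 0 := by
  have h1 : a * ι e = 0 := by rw [← smul_eq_mul, ← map_smul, h, map_zero]
  rcases mul_eq_zero.mp h1 with h2 | h2
  · exact absurd h2 ha
  · exact hι (by rw [h2, map_zero])

/-- A module embedding `R`-linearly into `R` has rank `≤ 1`: any two elements `v, w` satisfy the relation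
`ι w • v − ι v • w = 0` (non-trivial unless `v = 0`, when `1 • v + 0 • w = 0`). [folklore] -/
theorem rank_le_one_of_injective [Nontrivial R] (ι : E →ₗ[R] R) (hι : Function.Injective ι) (v w : E) :
    ∃ a b : R, (a ≠ 0 ∨ b ≠ 0) ∧ a • v + b • w = 0 := by
  by_cases hv : ι v = 0
  · have hv0 : v = 0 := hι (by rw [hv, map_zero])
    exact ⟨1, 0, Or.inl one_ne_zero, by rw [hv0, smul_zero, zero_smul, add_zero]⟩
  · refine ⟨ι w, -ι v, Or.inr (neg_ne_zero.mpr hv), hι ?_⟩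
    rw [map_add, map_smul, map_smul, map_zero, smul_eq_mul, smul_eq_mul, neg_mul, mul_comm, add_neg_cancel]

/-- Rank `≤ 1` in the working form «any two elements are linearly dependent» from Mathlib's currency «no pair is linearly
independent». [folklore] -/
theorem rank_le_one_of_not_linearIndependent_pair (h : ∀ v w : E, ¬ LinearIndependent R ![v, w]) (v w : E) :
    ∃ a b : R, (a ≠ 0 ∨ b ≠ 0) ∧ a • v + b • w = 0 := by
  have h1 := h v w
  rw [LinearIndependent.pair_iff] at h1
  push Not at h1
  obtain ⟨s, t, hst, hne⟩ := h1
  refine ⟨s, t, ?_, hst⟩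
  by_contra h2
  push Not at h2
  exact hne h2.1 h2.2

end Embedding

/-! ## §2 The maximal common power of `ϖ` in a pair -/

section MaxPow

variable {R : Type*} [CommRing R]

/-- If not every power of `ϖ` divides both `a` and `b`, extract the maximal common power: `a = ϖⁿ a'`, `b = ϖⁿ b'` with
`¬(ϖ ∣ a' ∧ ϖ ∣ b')`. [folklore] -/
theorem exists_pow_mul_not_dvd_and (ϖ a b : R) (hfin : ∃ n : ℕ, ¬ (ϖ ^ n ∣ a ∧ ϖ ^ n ∣ b)) :
    ∃ (n : ℕ) (a' b' : R), a = ϖ ^ n * a' ∧ b = ϖ ^ n * b' ∧ ¬ (ϖ ∣ a' ∧ ϖ ∣ b') := by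
  classical
  have hN0 : Nat.find hfin ≠ 0 := by
    intro h0
    have h1 := Nat.find_spec hfin
    rw [h0, pow_zero] at h1
    exact h1 ⟨one_dvd _, one_dvd _⟩
  obtain ⟨n, hn⟩ := Nat.exists_eq_succ_of_ne_zero hN0
  have hle : n < Nat.find hfin := by omega
  have hdvd : ϖ ^ n ∣ a ∧ ϖ ^ n ∣ b := by
    have := Nat.find_min hfin hle
    push Not at this
    exact this
  obtain ⟨⟨a', ha'⟩, ⟨b', hb'⟩⟩ := hdvd
  refine ⟨n, a', b', ha', hb', ?_⟩
  rintro ⟨⟨a'', ha''⟩, ⟨b'', hb''⟩⟩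
  have hspec := Nat.find_spec hfin
  rw [hn] at hspec
  apply hspec
  refine ⟨⟨a'', ?_⟩, ⟨b'', ?_⟩⟩
  · rw [ha', ha'', pow_succ, mul_assoc]
  · rw [hb', hb'', pow_succ, mul_assoc]

end MaxPow

/-! ## §3 Rank one survives reduction mod `ϖ` -/

section ModP

variable {R : Type*} [CommRing R] {E : Type*} [AddCommGroup E] [Module R E]
  {V : Type*} [AddCommGroup V] [Module R V]

/-- **Rank `≤ 1` survives reduction mod `ϖ` (scalar form over `R`).**  Let `E` be torsion-free of rank `≤ 1` (any two elements
linearly dependent) over `R`, in which every non-zero scalar has finite `ϖ`-multiplicity, and let `q : E → V` be an `R`-linear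
surjection (the quotient map `Ē^χ → V_∞ = Ē^χ/2`, or any quotient).  Then any two elements of `V` satisfy a relation
`a • v + b • w = 0` whose coefficients are NOT both divisible by `ϖ`.  (Divide the relation lifted to `E` by the maximal common power
of `ϖ`, using torsion-freeness.) [folklore] -/
theorem rank_le_one_modP (ϖ : R)
    (htf : ∀ (a : R) (e : E), a ≠ 0 → a • e = 0 → e = 0)
    (hrank : ∀ v w : E, ∃ a b : R, (a ≠ 0 ∨ b ≠ 0) ∧ a • v + b • w = 0)
    (hfin : ∀ a : R, a ≠ 0 → ∃ n : ℕ, ¬ ϖ ^ n ∣ a)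
    (q : E →ₗ[R] V) (hq : Function.Surjective q) (v w : V) :
    ∃ a b : R, ¬ (ϖ ∣ a ∧ ϖ ∣ b) ∧ a • v + b • w = 0 := by
  obtain ⟨e, rfl⟩ := hq v
  obtain ⟨e', rfl⟩ := hq w
  obtain ⟨a, b, hab, h⟩ := hrank e e'
  have hfin' : ∃ n : ℕ, ¬ (ϖ ^ n ∣ a ∧ ϖ ^ n ∣ b) := by
    rcases hab with ha | hb
    · obtain ⟨n, hn⟩ := hfin a ha
      exact ⟨n, fun h' => hn h'.1⟩
    · obtain ⟨n, hn⟩ := hfin b hb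
      exact ⟨n, fun h' => hn h'.2⟩
  obtain ⟨n, a', b', ha', hb', hnd⟩ := exists_pow_mul_not_dvd_and ϖ a b hfin'
  have hpow : ϖ ^ n ≠ 0 := by
    intro h0
    rw [h0, zero_mul] at ha' hb'
    rcases hab with ha | hb
    · exact ha ha'
    · exact hb hb'
  have hrel : a' • e + b' • e' = 0 := by
    apply htf (ϖ ^ n) _ hpow
    rw [smul_add, ← mul_smul, ← mul_smul, ← ha', ← hb', h]
  refine ⟨a', b', hnd, ?_⟩
  rw [← map_smul, ← map_smul, ← map_add, hrel, map_zero]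

variable {S : Type*} [CommRing S] [Module S V]

/-- **Rank `≤ 1` survives reduction mod `ϖ` — the certificate's hypothesis `hrank` over `S = R/ϖ`.**  Same hypotheses, read through a
ring map `φ : R →+* S` that kills exactly the multiples of `ϖ` (`φ r = 0 ↔ ϖ ∣ r`; e.g. `Λ' → 𝔽₄⟦T⟧`) and an `S`-module structure on
`V` compatible with the `R`-structure (`r • v = φ r • v`): any two elements of `V` are `S`-linearly dependent,
`∃ a b : S, (a ≠ 0 ∨ b ≠ 0) ∧ a • v + b • w = 0` — LITERALLY the input `hrank` of
`isTorsion_quotient_iff_exists_proj_ne_zero` / `isTorsion_quotient_span_iff`. [folklore] -/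
theorem rank_le_one_modP_of_ringHom (ϖ : R) (φ : R →+* S) (hφ : ∀ r : R, φ r = 0 ↔ ϖ ∣ r)
    (htf : ∀ (a : R) (e : E), a ≠ 0 → a • e = 0 → e = 0)
    (hrank : ∀ v w : E, ∃ a b : R, (a ≠ 0 ∨ b ≠ 0) ∧ a • v + b • w = 0)
    (hfin : ∀ a : R, a ≠ 0 → ∃ n : ℕ, ¬ ϖ ^ n ∣ a)
    (q : E →ₗ[R] V) (hq : Function.Surjective q)
    (hcompat : ∀ (r : R) (v : V), r • v = φ r • v) (v w : V) :
    ∃ a b : S, (a ≠ 0 ∨ b ≠ 0) ∧ a • v + b • w = 0 := by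
  obtain ⟨a, b, hnd, h⟩ := rank_le_one_modP ϖ htf hrank hfin q hq v w
  refine ⟨φ a, φ b, ?_, by rw [← hcompat, ← hcompat, h]⟩
  by_contra h'
  push Not at h'
  exact hnd ⟨(hφ a).mp h'.1, (hφ b).mp h'.2⟩

/-- The same with the torsion-freeness and rank hypotheses supplied by an embedding `ι : E ↪ R` into a domain (§1): «`Ē^χ ↪ Λ'` a
rank-one lattice ⇒ `V_∞ = Ē^χ/2` has `𝔽₄⟦T⟧`-rank `≤ 1`». [folklore] -/
theorem rank_le_one_modP_of_injective [IsDomain R] (ι : E →ₗ[R] R) (hι : Function.Injective ι)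
    (ϖ : R) (φ : R →+* S) (hφ : ∀ r : R, φ r = 0 ↔ ϖ ∣ r)
    (hfin : ∀ a : R, a ≠ 0 → ∃ n : ℕ, ¬ ϖ ^ n ∣ a)
    (q : E →ₗ[R] V) (hq : Function.Surjective q)
    (hcompat : ∀ (r : R) (v : V), r • v = φ r • v) (v w : V) :
    ∃ a b : S, (a ≠ 0 ∨ b ≠ 0) ∧ a • v + b • w = 0 :=
  rank_le_one_modP_of_ringHom ϖ φ hφ (fun _ _ ha h => smul_left_cancel_of_injective ι hι ha h)
    (rank_le_one_of_injective ι hι) hfin q hq hcompat v w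

end ModP

end Summit.BirchSwinnertonDyer.BirchSwinnertonDyer.Theorems.SignedMuAtTwo.NonsquareDescent
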